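import Literature.AnabelianGeometry.Anabelioids.FiberRealization
import Literature.AnabelianGeometry.Anabelioids.ComponentsOrbits
import HarnessLib

/-!
# Anabelioids: one connected component iff the fibre action is transitive; objects with fibre `Π/U`

Mochizuki, *Semi-graphs of anabelioids*, Publ. RIMS **42** (2006), Def. 2.2 (i) p. 23 / Rem. 2.2.1
p. 24: the components of an object of a connected anabelioid are the orbits of `Π = Aut F` on its fibre
(tree: `ComponentsOrbits.lean`, abc-iut-L6-t17).  PROOF-ONLY consequences used by [SemiAnbd] Ex. 2.10
conjunct (3) (row G31 (3), seat abc-iut-w5-d195):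

* `subsingleton_π₀Obj_of_isPretransitive` — if `Aut F` acts transitively on `F(X)`, `X` has at most one
  connected component;
* `exists_ne_π₀Obj_of_not_mem_orbit` — two points of `F(X)` in different orbits lie on two DISTINCT
  components;
* `exists_obj_fibre_quotient` — for an open subgroup `U ≤ Aut F` there is an object `X` whose fibre is
  `Aut F`-isomorphic to `Aut F / U` (Mathlib's `exists_lift_of_quotient_openSubgroup`), packaged with the
  two facts G31 (3) needs: `X` has one component, and the stabiliser of every point of `F(X)` is a
  conjugate of `U`.

[cite: MochizukiSemiAnbd2006, Def. 2.2(i) p.23]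
-/

namespace Literature.AnabelianGeometry.Anabelioids

open CategoryTheory CategoryTheory.Limits CategoryTheory.Functor CategoryTheory.PreGaloisCategory
  Literature.AnabelianGeometry.SemiGraphs
open scoped Pointwise

universe u₁ u₂ w

variable {C : Type u₁} [Category.{u₂} C] [GaloisCategory C] (F : C ⥤ FintypeCat.{w}) [FiberFunctor F]

/-- **Transitive fibre ⇒ one component.** [cite: MochizukiSemiAnbd2006, Def. 2.2(i) p.23] -/
theorem subsingleton_π₀Obj_of_isPretransitive (X : C)
    [MulAction.IsPretransitive (Aut F) (F.obj X)] : Subsingleton (π₀Obj X) := by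
  refine ⟨fun P Q => ?_⟩
  haveI : IsConnected (P.1 : C) := P.2
  haveI : IsConnected (Q.1 : C) := Q.2
  obtain ⟨p⟩ := nonempty_fiber_of_isConnected F (P.1 : C)
  obtain ⟨q⟩ := nonempty_fiber_of_isConnected F (Q.1 : C)
  rw [component_eq_iff_range_eq F P Q,
    range_map_arrow_eq_orbit F P ⟨p, rfl⟩, range_map_arrow_eq_orbit F Q ⟨q, rfl⟩,
    MulAction.orbit_eq_univ, MulAction.orbit_eq_univ]

/-- **Points in different orbits lie on different components.** [cite: MochizukiSemiAnbd2006, Def. 2.2(i) p.23] -/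
theorem exists_ne_π₀Obj_of_not_mem_orbit {X : C} (x y : F.obj X)
    (h : y ∉ MulAction.orbit (Aut F) x) : ∃ P Q : π₀Obj X, P ≠ Q := by
  obtain ⟨P, hP⟩ := exists_component_mem_range F x
  obtain ⟨Q, hQ⟩ := exists_component_mem_range F y
  refine ⟨P, Q, fun hPQ => h ?_⟩
  subst hPQ
  rw [range_map_arrow_eq_orbit F P hP] at hQ
  exact hQ

/-- The stabiliser of the coset `γ U` under left multiplication is `γ U γ⁻¹` (Rem. 2.2.1: "the
stabilizers … conjugates"). [cite: MochizukiSemiAnbd2006, Rem. 2.2.1 p.24] -/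
theorem stabilizer_quotient_mk {G : Type*} [Group G] (U : Subgroup G) (γ : G) :
    MulAction.stabilizer G (QuotientGroup.mk γ : G ⧸ U) = ConjAct.toConjAct γ • U := by
  ext g
  rw [MulAction.mem_stabilizer_iff, MulAction.Quotient.smul_mk, smul_eq_mul, QuotientGroup.eq,
    Subgroup.mem_pointwise_smul_iff_inv_smul_mem, ← _root_.map_inv, ConjAct.smul_def,
    ConjAct.ofConjAct_toConjAct, inv_inv, mul_inv_rev]
  constructor
  · intro h
    simpa [mul_assoc, mul_inv_rev] using U.inv_mem h
  · intro h
    simpa [mul_assoc, mul_inv_rev] using U.inv_mem h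

/-- **An object with fibre `Aut F / U`.**  For an open subgroup `U` of `Π := Aut F` there is an object
`X` together with a `Π`-equivariant bijection `F(X) ≃ Π/U` (tree: `exists_obj_fiber_equiv`, universe-
general form of Mathlib's `exists_lift_of_quotient_openSubgroup`); consequently `X` has exactly one
connected component and the stabiliser of every point of `F(X)` is a conjugate of `U`.
[cite: MochizukiSemiAnbd2006, Def. 2.2(i) p.23] -/
theorem exists_obj_fibre_quotient (U : Subgroup (Aut F)) (hU : IsOpen (U : Set (Aut F))) :
    ∃ (X : C) (e : F.obj X ≃ Aut F ⧸ U),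
      (∀ (σ : Aut F) (x : F.obj X), e (σ • x) = σ • e x) ∧ Subsingleton (π₀Obj X) ∧
        ∀ x : F.obj X, ∃ γ : Aut F, e x = QuotientGroup.mk γ ∧
          MulAction.stabilizer (Aut F) x = ConjAct.toConjAct γ • U := by
  haveI : Finite (Aut F ⧸ U) := Subgroup.quotient_finite_of_isOpen U hU
  have hstabU : ∀ q : Aut F ⧸ U, IsOpen (MulAction.stabilizer (Aut F) q : Set (Aut F)) := by
    intro q
    obtain ⟨γ, rfl⟩ := QuotientGroup.mk_surjective q
    rw [stabilizer_quotient_mk]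
    have hset : ((ConjAct.toConjAct γ • U : Subgroup (Aut F)) : Set (Aut F)) =
        (fun x : Aut F => γ⁻¹ * x * γ) ⁻¹' (U : Set (Aut F)) := by
      ext x
      rw [SetLike.mem_coe, Subgroup.mem_pointwise_smul_iff_inv_smul_mem, ← _root_.map_inv,
        ConjAct.smul_def, ConjAct.ofConjAct_toConjAct, inv_inv, Set.mem_preimage, SetLike.mem_coe]
    rw [hset]
    exact hU.preimage ((continuous_const.mul continuous_id).mul continuous_const)
  obtain ⟨X, e, he⟩ := exists_obj_fiber_equiv F (Aut F ⧸ U) hstabU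
  have hstab : ∀ x : F.obj X, MulAction.stabilizer (Aut F) x = MulAction.stabilizer (Aut F) (e x) := by
    intro x; ext σ
    rw [MulAction.mem_stabilizer_iff, MulAction.mem_stabilizer_iff, ← he, e.apply_eq_iff_eq]
  refine ⟨X, e, he, ?_, fun x => ?_⟩
  · haveI : MulAction.IsPretransitive (Aut F) (F.obj X) := ⟨fun x y => by
      obtain ⟨gx, hx⟩ := QuotientGroup.mk_surjective (e x)
      obtain ⟨gy, hy⟩ := QuotientGroup.mk_surjective (e y)
      refine ⟨gy * gx⁻¹, e.injective ?_⟩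
      rw [he, ← hx, ← hy, MulAction.Quotient.smul_mk, smul_eq_mul, inv_mul_cancel_right]⟩
    exact subsingleton_π₀Obj_of_isPretransitive F X
  · obtain ⟨γ, hγ⟩ := QuotientGroup.mk_surjective (e x)
    exact ⟨γ, hγ.symm, by rw [hstab, ← hγ, stabilizer_quotient_mk]⟩

end Literature.AnabelianGeometry.Anabelioids
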